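import Summits.HodgeConjecture.HodgeConjecture.Theorems.PadicSemiregularLiftHodgeFermatVarietiesLevelRaiseSupply
import HarnessLib

/-!
# Stable reachability ascends along level raising — stub `stub_stableReach_levelRaise`, line `cancel-by-any-claim-lattice`, crux `HodgeFermatVarieties` (stmt-HodgeConjecture-1334)

The line proves the Hodge conjecture for the Fermat variety `Xⁿ_m` by showing that every Hodge
multiset of `ℤ/m` is STABLY ℤ-reachable from the printed supply: `StableReach[m, s]` says that for
some `k ≥ 1` the level-raised multiset `k • s = LevelRaise[k, m, s]` (pull-back of characters along
`π : Xⁿ_{km} → Xⁿ_m`, `[xᵢ] ↦ [xᵢᵏ]`, Shioda–Katsura 1979 §1; Aoki 1987 p. 387) is ℤ-reachable from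
the printed supply of level `km`, i.e. `k • s + ΣN = ΣP` for finite families `P`, `N` of supply
elements.

PROVED here (`stub_stableReach_levelRaise`, structural hygiene for the engine of the line): stable
reachability ASCENDS along level raising — if `s` is stably reachable at level `m`, then `g • s` is
stably reachable at level `gm` (`g ≥ 1`). Hence an imprimitive class `g • s'` of level `g m'` is
stably reachable as soon as `s'` is at level `m'`, and the engine is only needed for primitive classes.

PROOF. `StableReach[m, s]` gives `k ≥ 1` and supply families `P`, `N` of level `km` with
`k • s + ΣN = ΣP`. Raise this identity by `g`: level raising maps supply into supply (the landed stub
`LevelRaiseSupply.stub_levelRaise_mem_supply`) and is a `Multiset.map`, hence additive over `+` and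
`Σ`; this is a certificate for `g • (k • s)` at level `g(km)`. The target `StableReach[gm, g • s]`
asks (with the same `k`) for a certificate for `k • (g • s)` at level `k(gm)`. The two levels are equal
naturals; to avoid transporting along `ZMod (g(km)) = ZMod (k(gm))` the raising lemma is stated with a
FREE name `L` for the target level (`reach_levelRaise_freeLevel`, `subst` inside) and instantiated at
`L := k(gm)`; finally `g • (k • s)` and `k • (g • s)` are both `s.map (y ↦ g k ⟨y⟩ mod L)` entrywise,
because `⟨k • y⟩ = k⟨y⟩` (`LevelRaiseSupply.val_levelRaise`).

Only the arithmetic of `ℤ/m`; no geometry.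

## References

* [ShiodaKatsura1979] T. Shioda, T. Katsura, On Fermat varieties, Tôhoku Math. J. 31 (1979)
  97–115, §1 (the morphisms `Xⁿ_{km} → Xⁿ_m` and the inductive structure).
* [Aoki1987] N. Aoki, Some new algebraic cycles on Fermat varieties, J. Math. Soc. Japan 39 (1987)
  385–396, §1 p. 387 (the elements `g·σ` of level `m` coming from level `m/g`).
-/

-- `HodgeConjecture.HodgeConjecture` repeats by the single-problem Summits layout (as in every sibling file).
set_option linter.dupNamespace false

noncomputable section

open Finset
open Literature.AlgebraicGeometry.HodgeTheory Literature.AlgebraicGeometry.HodgeTheory.FermatCharacter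

namespace Summit.HodgeConjecture.HodgeConjecture.Theorems.CancelByAnyClaimLattice.LevelAscent

/-- `Supply[M]` — the printed supply of level `M` (local notation of the line, verbatim). -/
local notation3 (prettyPrint := false) "Supply[" M "]" =>
  ({s : Multiset (ZMod M) | ∃ a : ZMod M, a ≠ 0 ∧ s = ({a, -a} : Multiset (ZMod M))} ∪
    {s : Multiset (ZMod M) | IsHodgeMultiset s ∧ Multiset.card s = 4} ∪
    {s : Multiset (ZMod M) | IsHodgeMultiset s ∧ IsSemiDecomposable s} ∪
    {s : Multiset (ZMod M) | ∃ (p : ℕ) (a : ZMod M), p.Prime ∧ p ≠ 2 ∧ p ∣ M ∧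
        2 < (M / p) / Nat.gcd (ZMod.val a) (M / p) ∧
        s = Multiset.map (fun j : ℕ => a + (j : ZMod M) * ((M / p : ℕ) : ZMod M)) (Multiset.range p) +
              {-((p : ZMod M) * a)}} : Set (Multiset (ZMod M)))

/-- `Reach[M, s]` (local notation of the line, verbatim). -/
local notation3 (prettyPrint := false) "Reach[" M ", " s "]" =>
  ∃ P N : Multiset (Multiset (ZMod M)),
    (∀ u ∈ P, u ∈ Supply[M]) ∧ (∀ u ∈ N, u ∈ Supply[M]) ∧ s + Multiset.sum N = Multiset.sum P

/-- `LevelRaise[k, m, s]` (local notation of the line, verbatim). -/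
local notation3 (prettyPrint := false) "LevelRaise[" k ", " m ", " s "]" =>
  Multiset.map (fun a : ZMod m => ((k * ZMod.val a : ℕ) : ZMod (k * m))) s

/-- `StableReach[m, s]` (local notation of the line, verbatim). -/
local notation3 (prettyPrint := false) "StableReach[" m ", " s "]" => ∃ k : ℕ, 0 < k ∧ Reach[k * m, LevelRaise[k, m, s]]

variable {M : ℕ}

/-! ### Level raising is monotone for `Reach`, with a free name for the target level -/

/-- **`Reach` ascends along level raising, free-level form.** If `s` is ℤ-reachable from the printed
supply of level `M` and `k ≥ 1`, then `k • s` is ℤ-reachable from the printed supply of level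
`L = kM`: map both supply families through `LevelRaise[k, M, ·]`, which lands in the supply of level
`kM` elementwise (stub S8, `LevelRaiseSupply.stub_levelRaise_mem_supply`) and is additive over `+`
and `Σ` (`Multiset.map_add`, `map_multiset_sum`). The target level carries a free name `L` with
`L = k * M` substituted inside, so that the lemma can be used at a level written differently
(`g(kM)` versus `k(gM)`). [cite: ShiodaKatsura1979, §1 (the morphisms between Fermat varieties of levels kM and M)] -/
theorem reach_levelRaise_freeLevel [NeZero M] {k L : ℕ} (hk : 0 < k) (hL : L = k * M)
    {s : Multiset (ZMod M)} (h : Reach[M, s]) :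
    ∃ P N : Multiset (Multiset (ZMod L)), (∀ u ∈ P, u ∈ Supply[L]) ∧ (∀ u ∈ N, u ∈ Supply[L]) ∧
      s.map (fun y ↦ ((k * ZMod.val y : ℕ) : ZMod L)) + N.sum = P.sum := by
  subst hL
  obtain ⟨P, N, hP, hN, h⟩ := h
  refine ⟨P.map (fun u ↦ LevelRaise[k, M, u]), N.map (fun u ↦ LevelRaise[k, M, u]), ?_, ?_, ?_⟩
  · intro u hu
    obtain ⟨u', hu', rfl⟩ := Multiset.mem_map.mp hu
    exact LevelRaiseSupply.stub_levelRaise_mem_supply M k hk u' (hP u' hu')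
  · intro u hu
    obtain ⟨u', hu', rfl⟩ := Multiset.mem_map.mp hu
    exact LevelRaiseSupply.stub_levelRaise_mem_supply M k hk u' (hN u' hu')
  · have := congrArg (fun X : Multiset (ZMod M) ↦ LevelRaise[k, M, X]) h
    simp only [Multiset.map_add, map_multiset_sum] at this
    exact this

/-- **Two level raisings commute entrywise**: `k • (g • s)` (level `k(gm)`) equals `g • (k • s)` read
at the same level, both being `s.map (y ↦ g k ⟨y⟩)`, since `⟨k • y⟩ = k⟨y⟩` and `⟨g • y⟩ = g⟨y⟩`
(`LevelRaiseSupply.val_levelRaise`). [folklore] -/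
theorem levelRaise_levelRaise_eq_map [NeZero M] {g k : ℕ} (hg : 0 < g) (hk : 0 < k)
    (s : Multiset (ZMod M)) :
    LevelRaise[k, g * M, LevelRaise[g, M, s]] =
      (LevelRaise[k, M, s]).map (fun y ↦ ((g * ZMod.val y : ℕ) : ZMod (k * (g * M)))) := by
  haveI : NeZero (k * M) := ⟨Nat.mul_ne_zero hk.ne' (NeZero.ne M)⟩
  haveI : NeZero (g * M) := ⟨Nat.mul_ne_zero hg.ne' (NeZero.ne M)⟩
  rw [Multiset.map_map, Multiset.map_map]
  refine Multiset.map_congr rfl fun y _ ↦ ?_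
  simp only [Function.comp_apply]
  rw [LevelRaiseSupply.val_levelRaise hg, LevelRaiseSupply.val_levelRaise hk, Nat.mul_left_comm k g (ZMod.val y)]

/-! ### The stub -/

/-- **`stub_stableReach_levelRaise` — stable reachability ascends along level raising.** If a
multiset `s` of `ℤ/m` is stably ℤ-reachable from the printed supply (`k • s + ΣN = ΣP` at some level
`km`, `k ≥ 1`), then for every `g ≥ 1` the level-raised multiset `g • s` of `ℤ/gm` is stably
ℤ-reachable, with the same `k`: raise the certificate by `g` into level `g(km) = k(gm)`
(`reach_levelRaise_freeLevel`: level raising maps supply into supply and is additive) and identify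
`g • (k • s)` with `k • (g • s)` entrywise (`levelRaise_levelRaise_eq_map`). Consequently an
imprimitive class `g • s'` of level `g m'` is stably reachable as soon as `s'` is (level `m'`); the
engine of the line is needed for primitive classes only.
[cite: ShiodaKatsura1979, §1 (inductive structure along the morphisms of Fermat varieties of levels kM → M)] -/
theorem stub_stableReach_levelRaise :
    ∀ (m g : ℕ) [NeZero m], 0 < g → ∀ s : Multiset (ZMod m), StableReach[m, s] → StableReach[g * m, LevelRaise[g, m, s]] := by
  intro m g _ hg s hs
  obtain ⟨k, hk, hreach⟩ := hs
  haveI : NeZero (k * m) := ⟨Nat.mul_ne_zero hk.ne' (NeZero.ne m)⟩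
  haveI : NeZero (g * m) := ⟨Nat.mul_ne_zero hg.ne' (NeZero.ne m)⟩
  refine ⟨k, hk, ?_⟩
  obtain ⟨P, N, hP, hN, h⟩ :=
    reach_levelRaise_freeLevel (M := k * m) (k := g) (L := k * (g * m)) hg (by ring) hreach
  refine ⟨P, N, hP, hN, ?_⟩
  rw [levelRaise_levelRaise_eq_map hg hk s]
  exact h

end Summit.HodgeConjecture.HodgeConjecture.Theorems.CancelByAnyClaimLattice.LevelAscent

end
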